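import Literature.Computability.Complexity.StackItemPop
import HarnessLib

/-!
# Moving items between list registers in linear time

Trunk complexity toolkit, continuing `StackItemPop.lean` (`popItemFast`: the first item of a
list register in `8|v| + 10` steps) and `StackItemLists.lean` (`pushItem`, `4|v| + 5` steps;
`moveItems` there costs `13|L₁|` per item because it is built on the draining `popItem`).
Here the two are combined along register assignments (`Com.map`, `graft`) into

* `Com.moveItemFast` on `MFReg = {L₁, L₂, A, S, W, C}`: move the first item of `L₁` onto `L₂`
  in `12|v| + 15` steps (`runs_moveItemFast`);
* `Com.moveItemsFast = loop C moveItemFast moveItemFast`: move `|C|` items (the counter `C` is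
  consumed), the moved items ending *reversed* on top of `L₂` (a stack pour), within
  `|C| · (12N + 17) + 1` steps when every payload has length `≤ N` (`runs_moveItemsFast`) —
  linear in the data moved, independent of what lies below.

This is the data-movement primitive of streaming passes (split a list in two, pour, merge)
for (quasi-)linear-time stack programs.

## References

* S. Arora, B. Barak, *Computational Complexity: A Modern Approach*, CUP 2009, §0.1, §1.3.
* T. Nipkow, G. Klein, *Concrete Semantics with Isabelle/HOL*, Springer 2014, §7.2.
-/

namespace Literature.Computability.Complexity

open _root_.Computability

namespace Com

/-! ### Register file and assignments -/

/-- Registers of the item mover: source list `L₁`, target list `L₂`, payload `A`, sign `S`,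
token `W`, counter `C`. [folklore] -/
inductive MFReg where
  | L₁ | L₂ | A | S | W | C
  deriving DecidableEq, Fintype, Repr

namespace MFReg

/-- Register files of `MFReg` by their six contents. [folklore] -/
def file (l₁ l₂ a s w c : List Bool) : Regs MFReg
  | .L₁ => l₁ | .L₂ => l₂ | .A => a | .S => s | .W => w | .C => c

section
variable (l₁ l₂ a s w c v : List Bool)
/-- Reading `L₁`. [folklore] -/ @[simp] theorem file_L₁ : file l₁ l₂ a s w c .L₁ = l₁ := rfl
/-- Reading `L₂`. [folklore] -/ @[simp] theorem file_L₂ : file l₁ l₂ a s w c .L₂ = l₂ := rfl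
/-- Reading `A`. [folklore] -/ @[simp] theorem file_A : file l₁ l₂ a s w c .A = a := rfl
/-- Reading `S`. [folklore] -/ @[simp] theorem file_S : file l₁ l₂ a s w c .S = s := rfl
/-- Reading `W`. [folklore] -/ @[simp] theorem file_W : file l₁ l₂ a s w c .W = w := rfl
/-- Reading `C`. [folklore] -/ @[simp] theorem file_C : file l₁ l₂ a s w c .C = c := rfl
/-- Writing `C`. [folklore] -/
@[simp] theorem update_file_C : Function.update (file l₁ l₂ a s w c) .C v = file l₁ l₂ a s w v := by
  funext r; cases r <;> rfl
end

/-- The register assignment of `popItemFast` (source list `L₁`). [folklore] -/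
def ofPF : PFReg → MFReg
  | .L => .L₁ | .A => .A | .S => .S | .W => .W

/-- The register assignment of `pushItem` (target list `L₂`). [folklore] -/
def ofPU : PUReg → MFReg
  | .A => .A | .S => .S | .L => .L₂

/-- `ofPF` is injective. [folklore] -/
theorem ofPF_injective : Function.Injective ofPF := by
  intro a b h; cases a <;> cases b <;> first | rfl | cases h

/-- `ofPU` is injective. [folklore] -/
theorem ofPU_injective : Function.Injective ofPU := by
  intro a b h; cases a <;> cases b <;> first | rfl | cases h

/-- Grafting a `popItemFast` file. [folklore] -/
@[simp] theorem graft_ofPF (l₁ l₂ a s w c l' a' s' w' : List Bool) :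
    graft (file l₁ l₂ a s w c) ofPF (PFReg.file l' a' s' w') = file l' l₂ a' s' w' c := by
  funext r
  cases r
  · exact graft_apply _ ofPF_injective _ PFReg.L
  · exact graft_of_not _ _ _ (fun i => by cases i <;> simp [ofPF])
  · exact graft_apply _ ofPF_injective _ PFReg.A
  · exact graft_apply _ ofPF_injective _ PFReg.S
  · exact graft_apply _ ofPF_injective _ PFReg.W
  · exact graft_of_not _ _ _ (fun i => by cases i <;> simp [ofPF])

/-- Grafting a `pushItem` file. [folklore] -/
@[simp] theorem graft_ofPU (l₁ l₂ a s w c a' s' l' : List Bool) :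
    graft (file l₁ l₂ a s w c) ofPU (PUReg.file a' s' l') = file l₁ l' a' s' w c := by
  funext r
  cases r
  · exact graft_of_not _ _ _ (fun i => by cases i <;> simp [ofPU])
  · exact graft_apply _ ofPU_injective _ PUReg.L
  · exact graft_apply _ ofPU_injective _ PUReg.A
  · exact graft_apply _ ofPU_injective _ PUReg.S
  · exact graft_of_not _ _ _ (fun i => by cases i <;> simp [ofPU])
  · exact graft_of_not _ _ _ (fun i => by cases i <;> simp [ofPU])

end MFReg

open MFReg

/-! ### One item -/

/-- `moveItemFast`: move the first item of `L₁` onto `L₂` (through `A`, `S`). [folklore] -/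
def moveItemFast : Com MFReg := popItemFast.map ofPF ;; pushItem.map ofPU

/-- **Simulation of `moveItemFast`**: `L₁ = encItem v s ++ rest ↦ rest`,
`L₂ = l₂ ↦ encItem v s ++ l₂`, within `12|v| + 15` steps (from `A = S = W = []`), whatever
`rest` is. [folklore] -/
theorem runs_moveItemFast (v : List Bool) (s : Bool) (rest l₂ c : List Bool) :
    Runs moveItemFast (file (encItem v s ++ rest) l₂ [] [] [] c)
      (file rest (encItem v s ++ l₂) [] [] [] c) (8 * v.length + 10 + (4 * v.length + 5)) := by
  have h1 := Runs.map ofPF_injective (runs_popItemFast v s rest [])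
    (file (encItem v s ++ rest) l₂ [] [] [] c) (fun i => by cases i <;> rfl)
  rw [graft_ofPF, List.append_nil] at h1
  have h2 := Runs.map ofPU_injective (runs_pushItem v s l₂) (file rest l₂ v (flag s) [] c)
    (fun i => by cases i <;> rfl)
  rw [graft_ofPU] at h2
  exact h1.seq h2

/-! ### Counted moves -/

/-- `moveItemsFast`: move as many items from `L₁` onto `L₂` as the counter `C` has bits
(`C` is consumed). [folklore] -/
def moveItemsFast : Com MFReg := loop .C moveItemFast moveItemFast

/-- **Simulation of `moveItemsFast`**: with a counter of length `n ≤ |ws|` and the items `ws`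
on `L₁` above `r`, the first `n` items end reversed on top of `L₂`, within
`n · (12N + 17) + 1` steps if every payload has length `≤ N`. [folklore] -/
theorem runs_moveItemsFast (N : ℕ) : ∀ (cnt : List Bool) (ws : List (List Bool × Bool))
    (r l₂ : List Bool), cnt.length ≤ ws.length → (∀ p ∈ ws, p.1.length ≤ N) →
    Runs moveItemsFast (file (encItems ws ++ r) l₂ [] [] [] cnt)
      (file (encItems (ws.drop cnt.length) ++ r) (encItems (ws.take cnt.length).reverse ++ l₂)
        [] [] [] [])
      (cnt.length * (12 * N + 17) + 1) := by
  intro cnt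
  induction cnt with
  | nil =>
    intro ws r l₂ _ _
    exact (Runs.loop_nil _ _ (R := file (encItems ws ++ r) l₂ [] [] [] []) rfl).of_eq
      (by simp) (by simp)
  | cons b cnt ih =>
    intro ws r l₂ hlen hN
    obtain _ | ⟨⟨v, s⟩, ws⟩ := ws
    · simp at hlen
    · simp only [List.length_cons, Nat.succ_le_succ_iff] at hlen
      have hv : v.length ≤ N := hN (v, s) (by simp)
      have hmv := runs_moveItemFast v s (encItems ws ++ r) l₂ cnt
      have hih := ih ws r (encItem v s ++ l₂) hlen (fun p hp => hN p (by simp [hp]))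
      have e : encItems (List.take (cnt.length + 1) ((v, s) :: ws)).reverse ++ l₂ =
          encItems (ws.take cnt.length).reverse ++ (encItem v s ++ l₂) := by
        simp [List.take_succ_cons, encItems_append]
      have hcost : 8 * v.length + 10 + (4 * v.length + 5) + 2 + (cnt.length * (12 * N + 17) + 1) ≤
          (cnt.length + 1) * (12 * N + 17) + 1 := by nlinarith
      simp only [List.length_cons, List.drop_succ_cons, encItems_cons, List.append_assoc]
      rw [e]
      cases b
      · exact (Runs.loop_false' (R := file (encItem v s ++ (encItems ws ++ r)) l₂ [] [] [] (false :: cnt))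
          (R₀ := file (encItem v s ++ (encItems ws ++ r)) l₂ [] [] [] cnt) (w := cnt) rfl (by simp)
          hmv hih).of_eq rfl hcost
      · exact (Runs.loop_true' (R := file (encItem v s ++ (encItems ws ++ r)) l₂ [] [] [] (true :: cnt))
          (R₀ := file (encItem v s ++ (encItems ws ++ r)) l₂ [] [] [] cnt) (w := cnt) rfl (by simp)
          hmv hih).of_eq rfl hcost

end Com

end Literature.Computability.Complexity
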